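import Summits.RiemannHypothesis.RiemannHypothesis.Theorems.SoloInformedGroundStateEquivalence
import Summits.RiemannHypothesis.RiemannHypothesis.Theorems.SoloInformedQuasiWeilExact
import Literature.NumberTheory.LFunctions.WeilGroundEnergyParitySplit

/-!
# Ground-state endgame, VI: the reflection defect, and where negativity can live

Solo programme `solo-RiemannHypothesis-informed`, session 4.

Write `ĝ(s) = weilMellin g s`, `m(ρ)` for the multiplicity, `ρ* := 1 − ρ̄` (a multiplicity-
preserving involution of the zero index `weilZeroIndex T`, fixing exactly the zeros on the
critical line), and for a truncation height `T`

* `Z_T(g) := Σ_{|Im ρ| ≤ T} m(ρ) |ĝ(ρ)|²`      — the ZERO-SAMPLING ENERGY (a sum of squares,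
  unconditionally non-negative),
* `D_T(g) := Σ_{|Im ρ| ≤ T} m(ρ) |ĝ(ρ) − ĝ(ρ*)|²` — the REFLECTION DEFECT (non-negative; its
  on-line terms vanish identically, so it is a sum over OFF-LINE zeros only,
  `defectSum_eq_offline`).

THE DEFECT IDENTITY (`re_weilZeroSidePartial_weilQuadratic_eq`, unconditional, exact):

  `Re Σ_{|Im ρ| ≤ T} m(ρ) (g ⋆ g̃)^(ρ) = Z_T(g) − D_T(g) / 2`,

because `(g ⋆ g̃)^(ρ) = ĝ(ρ) conj ĝ(ρ*)` and `2 Re(x ȳ) = |x|² + |y|² − |x − y|²`.  Letting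
`T → ∞` (Weil's explicit formula, `explicit_formula_holds`): Weil's functional is the
zero-sampling energy minus half the reflection defect.  The two one-sided bounds already in the
tree (`norm_weilZeroSidePartial_weilQuadratic_le`: `|Q| ≤ Z`; `re_weilZeroSidePartial_weilQuadratic_ge`:
`Re Q ≥ −Z^{off}`) are the two halves of this identity (note `D ≤ 4 Z^{off}`, by `|x − y|² ≤ 2|x|² + 2|y|²`
and the reflection symmetry of the off-line multiset, whence `Re Q ≥ Z^{on} − Z^{off}`).

CONSEQUENCE — WHERE NEGATIVITY CAN LIVE.  Since `|Re Q(g)| ≤ sup_T Z_T(g)`, a test function can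
only witness ground energy `ε(a) < −t` if its own zero-sampling energy exceeds `t`
(`exists_zeroSum_gt_of_weilGroundEnergy_lt`): the NEAR-RADICAL of the window (tests with tiny
`Z`, e.g. the truncated prolate / `E`-map images on which Connes's analysis of the ground state
takes place, where `|Q| ≤ Z ≲ e^{−c e^{2a}}`, cf. `weilGroundEnergy_exp_exp_decay`) is blind to
the Riemann hypothesis; all of RH is the statement that near-minimisers do NOT need large `Z`.
Precisely (`riemannHypothesis_iff_near_minimisers_zeroSum_bounded`):

  `RH ↔ ∃ B a₀, ∀ a ≥ a₀, ∃ g s, IsWeilTest g ∧ Re Q(g) ≤ ε(a) + s ∧ s ≤ B ∧ ∀ T, Z_T(g) ≤ B`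

— on all large windows the ground energy is approached, to within a bounded slack, by tests of
bounded zero-sampling energy; and if RH fails, every near-minimiser sequence has `Z → ∞`
(indeed `≥ |ε(a)| − s`, which is `> C e^{κ a}` infinitely often by the thermometer
`weilGroundEnergy_dichotomy`).  No support, normalisation, distance or regularity hypothesis
on `g` is needed: this is the final, hypothesis-free form of the visibility criterion of part V.
-/

noncomputable section

open Complex Filter Set Topology Metric MeasureTheory
open Literature.NumberTheory.LFunctions Literature.NumberTheory.LFunctions.WeilContinuous
open scoped ComplexConjugate

namespace Summit.RiemannHypothesis.RiemannHypothesis.Theorems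

section Defect

variable {g : ℝ → ℂ}

/-- `2 Re(x ȳ) = |x|² + |y|² − |x − y|²`, in the form used below. -/
theorem re_mul_conj_eq_half_sq (x y : ℂ) :
    (x * conj y).re = (‖x‖ ^ 2 + ‖y‖ ^ 2 - ‖x - y‖ ^ 2) / 2 := by
  simp only [← Complex.normSq_eq_norm_sq, Complex.normSq_apply, Complex.mul_re, Complex.conj_re,
    Complex.conj_im, Complex.sub_re, Complex.sub_im]
  ring

/-- **The defect identity** (unconditional, every truncation height):
`Re Σ_{|Im ρ| ≤ T} m(ρ) (g ⋆ g̃)^(ρ) = Σ m(ρ)|ĝ(ρ)|² − ½ Σ m(ρ)|ĝ(ρ) − ĝ(1 − ρ̄)|²`. -/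
theorem re_weilZeroSidePartial_weilQuadratic_eq (hg : IsWeilTest g) (T : ℝ) :
    (weilZeroSidePartial (weilConv g (weilReflect g)) T).re =
      (∑ᶠ ρ ∈ weilZeroIndex T, (riemannZetaZeroOrder ρ : ℝ) * ‖weilMellin g ρ‖ ^ 2) -
        (∑ᶠ ρ ∈ weilZeroIndex T,
          (riemannZetaZeroOrder ρ : ℝ) * ‖weilMellin g ρ - weilMellin g (1 - conj ρ)‖ ^ 2) / 2 := by
  have hfin := weilZeroIndex_finite T
  have hmem : ∀ ρ, ρ ∈ hfin.toFinset ↔ ρ ∈ weilZeroIndex T := fun ρ ↦ hfin.mem_toFinset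
  unfold weilZeroSidePartial
  rw [finsum_mem_eq_finite_toFinset_sum _ hfin, finsum_mem_eq_finite_toFinset_sum _ hfin,
    finsum_mem_eq_finite_toFinset_sum _ hfin, Complex.re_sum]
  set F := hfin.toFinset with hF
  have hterm : ∀ ρ ∈ F,
      ((riemannZetaZeroOrder ρ : ℂ) * weilMellin (weilConv g (weilReflect g)) ρ).re =
        ((riemannZetaZeroOrder ρ : ℝ) * ‖weilMellin g ρ‖ ^ 2 +
            (riemannZetaZeroOrder ρ : ℝ) * ‖weilMellin g (1 - conj ρ)‖ ^ 2) / 2 -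
          (riemannZetaZeroOrder ρ : ℝ) * ‖weilMellin g ρ - weilMellin g (1 - conj ρ)‖ ^ 2 / 2 := by
    intro ρ _
    rw [weilMellin_weilQuadratic hg, ← Complex.ofReal_intCast, Complex.re_ofReal_mul,
      re_mul_conj_eq_half_sq]
    ring
  have hreindex : ∑ ρ ∈ F, (riemannZetaZeroOrder ρ : ℝ) * ‖weilMellin g (1 - conj ρ)‖ ^ 2 =
      ∑ ρ ∈ F, (riemannZetaZeroOrder ρ : ℝ) * ‖weilMellin g ρ‖ ^ 2 := by
    refine Finset.sum_nbij' (fun ρ ↦ 1 - conj ρ) (fun ρ ↦ 1 - conj ρ) ?_ ?_ ?_ ?_ ?_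
    · intro ρ hρ
      exact (hmem _).2 (one_sub_conj_mem_weilZeroIndex ((hmem ρ).1 hρ))
    · intro ρ hρ
      exact (hmem _).2 (one_sub_conj_mem_weilZeroIndex ((hmem ρ).1 hρ))
    · intro ρ _
      simp
    · intro ρ _
      simp
    · intro ρ hρ
      obtain ⟨h0, h1⟩ := re_pos_and_lt_one_of_mem_weilZeroIndex ((hmem ρ).1 hρ)
      simp only [riemannZetaZeroOrder_one_sub_conj h0 h1]
  rw [Finset.sum_congr rfl hterm, Finset.sum_sub_distrib, ← Finset.sum_div, ← Finset.sum_div,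
    Finset.sum_add_distrib, hreindex]
  ring

/-- The on-line terms of the defect vanish: the defect sum is a sum over OFF-LINE zeros only. -/
theorem defectSum_eq_offline (g : ℝ → ℂ) (T : ℝ) :
    (∑ᶠ ρ ∈ weilZeroIndex T,
        (riemannZetaZeroOrder ρ : ℝ) * ‖weilMellin g ρ - weilMellin g (1 - conj ρ)‖ ^ 2) =
      ∑ᶠ ρ ∈ weilZeroIndex T ∩ {ρ | ρ.re ≠ 1 / 2},
        (riemannZetaZeroOrder ρ : ℝ) * ‖weilMellin g ρ - weilMellin g (1 - conj ρ)‖ ^ 2 := by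
  have hfin := weilZeroIndex_finite T
  have hfin' : (weilZeroIndex T ∩ {ρ | ρ.re ≠ 1 / 2}).Finite := hfin.subset inter_subset_left
  have hoff : hfin'.toFinset = hfin.toFinset.filter (fun ρ ↦ ρ.re ≠ 1 / 2) := by
    ext ρ
    simp [Set.Finite.mem_toFinset, Finset.mem_filter, weilZeroIndex]
  rw [finsum_mem_eq_finite_toFinset_sum _ hfin, finsum_mem_eq_finite_toFinset_sum _ hfin', hoff]
  symm
  refine Finset.sum_filter_of_ne fun ρ _ hne ↦ ?_
  intro hre
  apply hne
  have h1 : 1 - conj ρ = ρ := by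
    apply Complex.ext
    · simp only [sub_re, one_re, conj_re, hre]; norm_num
    · simp
  simp [h1]

/-- The defect is non-negative … -/
theorem defectSum_nonneg (g : ℝ → ℂ) (T : ℝ) :
    0 ≤ ∑ᶠ ρ ∈ weilZeroIndex T,
      (riemannZetaZeroOrder ρ : ℝ) * ‖weilMellin g ρ - weilMellin g (1 - conj ρ)‖ ^ 2 := by
  refine finsum_nonneg fun ρ ↦ finsum_nonneg fun hρ ↦ ?_
  exact mul_nonneg (riemannZetaZeroOrder_nonneg_of_mem_weilZeroIndex hρ) (sq_nonneg _)

/-- … so the truncated zero side of `Q(g)` never exceeds the zero-sampling energy (the upper half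
of `norm_weilZeroSidePartial_weilQuadratic_le`, now as an exact consequence of the identity). -/
theorem re_weilZeroSidePartial_weilQuadratic_le_zeroSum (hg : IsWeilTest g) (T : ℝ) :
    (weilZeroSidePartial (weilConv g (weilReflect g)) T).re ≤
      ∑ᶠ ρ ∈ weilZeroIndex T, (riemannZetaZeroOrder ρ : ℝ) * ‖weilMellin g ρ‖ ^ 2 := by
  rw [re_weilZeroSidePartial_weilQuadratic_eq hg T]
  linarith [defectSum_nonneg g T]

end Defect

/-! ## Where negativity can live: near-minimisers must carry the zero-sampling energy -/

section Negativity

variable {g : ℝ → ℂ} {a s B : ℝ}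

/-- A near-minimiser with bounded zero sums bounds the ground energy from below:
`Re Q(g) ≤ ε(a) + s` and `Z_T(g) ≤ B` for all `T` give `ε(a) ≥ −(B + s)`.  (No support or
normalisation hypothesis on `g`.) -/
theorem weilGroundEnergy_ge_of_near_minimiser_zeroSum_le (hg : IsWeilTest g)
    (hmin : (weilQuadratic g).re ≤ weilGroundEnergy a + s)
    (hB : ∀ T : ℝ, ∑ᶠ ρ ∈ weilZeroIndex T, (riemannZetaZeroOrder ρ : ℝ) * ‖weilMellin g ρ‖ ^ 2 ≤ B) :
    -(B + s) ≤ weilGroundEnergy a := by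
  have h1 : ‖weilQuadratic g‖ ≤ B := norm_weilQuadratic_le_of_zeroSum_le hg hB
  have h2 : -B ≤ (weilQuadratic g).re := by
    have := Complex.abs_re_le_norm (weilQuadratic g)
    have := neg_abs_le (weilQuadratic g).re
    linarith
  linarith

/-- **Negativity needs zero-sampling energy.**  If `ε(a) < −(B + s)` then every test with
`Re Q(g) ≤ ε(a) + s` has a truncated zero sum `Z_T(g) > B`. -/
theorem exists_zeroSum_gt_of_weilGroundEnergy_lt (hg : IsWeilTest g)
    (hmin : (weilQuadratic g).re ≤ weilGroundEnergy a + s) (hε : weilGroundEnergy a < -(B + s)) :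
    ∃ T : ℝ, B < ∑ᶠ ρ ∈ weilZeroIndex T, (riemannZetaZeroOrder ρ : ℝ) * ‖weilMellin g ρ‖ ^ 2 := by
  by_contra h
  push Not at h
  exact absurd (weilGroundEnergy_ge_of_near_minimiser_zeroSum_le hg hmin h) (not_le.2 hε)

/-- In the critical strip the window bound reads `|k̂(ρ)| ≤ e^{a/2} √(2a) ‖k‖₂`. -/
theorem norm_weilMellin_le_window_of_mem {k : ℝ → ℂ} (hk : IsWeilTest k)
    (hks : tsupport k ⊆ Icc (-a) a) (ha : 0 ≤ a) {T : ℝ} {ρ : ℂ} (hρ : ρ ∈ weilZeroIndex T) :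
    ‖weilMellin k ρ‖ ≤ Real.exp (a / 2) * (Real.sqrt (2 * a) * Real.sqrt (∫ t, ‖k t‖ ^ 2)) := by
  obtain ⟨h0, h1⟩ := re_pos_and_lt_one_of_mem_weilZeroIndex hρ
  refine (norm_weilMellin_le_window hk hks ha _).trans
    (mul_le_mul_of_nonneg_right (Real.exp_le_exp.2 ?_) (by positivity))
  have hle : |ρ.re - 1 / 2| ≤ 1 / 2 := abs_le.2 ⟨by linarith, by linarith⟩
  nlinarith [mul_nonneg (sub_nonneg.2 hle) ha]

/-- `ℓ¹ → ℓ²` on a window: `Z_T(k) ≤ (e^{a/2}√(2a)‖k‖₂) · Z₁(k;T)`. -/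
theorem zeroSum_le_window_mul_zeroSumAbs {k : ℝ → ℂ} (hk : IsWeilTest k)
    (hks : tsupport k ⊆ Icc (-a) a) (ha : 0 ≤ a) (T : ℝ) :
    (∑ᶠ ρ ∈ weilZeroIndex T, (riemannZetaZeroOrder ρ : ℝ) * ‖weilMellin k ρ‖ ^ 2) ≤
      (Real.exp (a / 2) * (Real.sqrt (2 * a) * Real.sqrt (∫ t, ‖k t‖ ^ 2))) *
        ∑ᶠ ρ ∈ weilZeroIndex T, (riemannZetaZeroOrder ρ : ℝ) * ‖weilMellin k ρ‖ := by
  have hfin := weilZeroIndex_finite T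
  have hmem : ∀ ρ, ρ ∈ hfin.toFinset ↔ ρ ∈ weilZeroIndex T := fun ρ ↦ hfin.mem_toFinset
  rw [finsum_mem_eq_finite_toFinset_sum _ hfin, finsum_mem_eq_finite_toFinset_sum _ hfin,
    Finset.mul_sum]
  refine Finset.sum_le_sum fun ρ hρ ↦ ?_
  have hρ' := (hmem ρ).1 hρ
  have hm := riemannZetaZeroOrder_nonneg_of_mem_weilZeroIndex hρ'
  have hb := norm_weilMellin_le_window_of_mem hk hks ha hρ'
  have hn := norm_nonneg (weilMellin k ρ)
  calc (riemannZetaZeroOrder ρ : ℝ) * ‖weilMellin k ρ‖ ^ 2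
      = ‖weilMellin k ρ‖ * ((riemannZetaZeroOrder ρ : ℝ) * ‖weilMellin k ρ‖) := by ring
    _ ≤ (Real.exp (a / 2) * (Real.sqrt (2 * a) * Real.sqrt (∫ t, ‖k t‖ ^ 2))) *
          ((riemannZetaZeroOrder ρ : ℝ) * ‖weilMellin k ρ‖) :=
        mul_le_mul_of_nonneg_right hb (mul_nonneg hm hn)

/-- Under RH, near-minimisers of bounded zero-sampling energy exist on all large windows: the
unit near-null window tests of part IV (`exists_unit_nearNull_window`) have `Z_T ≤ C`, and by
Weil's criterion `ε(a) ≥ 0` while `Re Q ≤ |Q| ≤ C`. -/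
theorem near_minimisers_zeroSum_bounded_of_riemannHypothesis (hRH : RiemannHypothesis) :
    ∃ B a₀ : ℝ, ∀ a : ℝ, a₀ ≤ a → ∃ (g : ℝ → ℂ) (s : ℝ), IsWeilTest g ∧
      tsupport g ⊆ Icc (-a) a ∧ ∫ t, ‖g t‖ ^ 2 = 1 ∧ 0 ≤ s ∧
      (weilQuadratic g).re ≤ weilGroundEnergy a + s ∧ s ≤ B ∧
      ∀ T : ℝ, ∑ᶠ ρ ∈ weilZeroIndex T, (riemannZetaZeroOrder ρ : ℝ) * ‖weilMellin g ρ‖ ^ 2 ≤ B := by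
  obtain ⟨C, a₁, hC, h⟩ := exists_unit_nearNull_window
  refine ⟨C, max a₁ 1, fun a ha ↦ ?_⟩
  have ha₁ : a₁ ≤ a := (le_max_left _ _).trans ha
  have ha0 : 0 < a := by linarith [le_max_right a₁ 1]
  obtain ⟨k, hk, hks, hk1, hZ⟩ := h a ha₁
  have hE0 : 0 < Real.exp (a / 2) * Real.sqrt (2 * a) := by positivity
  have hA : ∀ T : ℝ, ∑ᶠ ρ ∈ weilZeroIndex T, (riemannZetaZeroOrder ρ : ℝ) * ‖weilMellin k ρ‖ ≤
      C / (Real.exp (a / 2) * Real.sqrt (2 * a)) := fun T ↦ by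
    rw [le_div_iff₀ hE0]
    exact hZ T
  have hZ2 : ∀ T : ℝ,
      ∑ᶠ ρ ∈ weilZeroIndex T, (riemannZetaZeroOrder ρ : ℝ) * ‖weilMellin k ρ‖ ^ 2 ≤ C := fun T ↦ by
    have h1 := zeroSum_le_window_mul_zeroSumAbs hk hks ha0.le T
    rw [hk1, Real.sqrt_one, mul_one] at h1
    refine h1.trans ?_
    calc (Real.exp (a / 2) * Real.sqrt (2 * a)) *
          ∑ᶠ ρ ∈ weilZeroIndex T, (riemannZetaZeroOrder ρ : ℝ) * ‖weilMellin k ρ‖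
        ≤ (Real.exp (a / 2) * Real.sqrt (2 * a)) * (C / (Real.exp (a / 2) * Real.sqrt (2 * a))) :=
          mul_le_mul_of_nonneg_left (hA T) hE0.le
      _ = C := mul_div_cancel₀ C hE0.ne'
  have hQ : ‖weilQuadratic k‖ ≤ C := norm_weilQuadratic_le_of_zeroSum_le hk hZ2
  have hre : (weilQuadratic k).re ≤ C :=
    (le_abs_self _).trans ((Complex.abs_re_le_norm _).trans hQ)
  have hε0 : 0 ≤ weilGroundEnergy a := weilGroundEnergy_nonneg_of_riemannHypothesis hRH ha0
  have hεle : weilGroundEnergy a ≤ (weilQuadratic k).re :=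
    weilGroundEnergy_le_re_weilQuadratic hk hks hk1
  exact ⟨k, (weilQuadratic k).re - weilGroundEnergy a, hk, hks, hk1, by linarith, by linarith,
    by linarith, hZ2⟩

/-- **RH from near-minimisers of bounded zero-sampling energy** (the converse: `ε(a) ≥ −2B` for
`a ≥ a₀`, monotonicity of the window infimum below `a₀`, and
`riemannHypothesis_iff_weilGroundEnergy_bddBelow`). -/
theorem riemannHypothesis_of_near_minimisers_zeroSum_bounded {B a₀ : ℝ}
    (h : ∀ a : ℝ, a₀ ≤ a → ∃ (g : ℝ → ℂ) (s : ℝ), IsWeilTest g ∧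
      (weilQuadratic g).re ≤ weilGroundEnergy a + s ∧ s ≤ B ∧
      ∀ T : ℝ, ∑ᶠ ρ ∈ weilZeroIndex T, (riemannZetaZeroOrder ρ : ℝ) * ‖weilMellin g ρ‖ ^ 2 ≤ B) :
    RiemannHypothesis := by
  refine riemannHypothesis_iff_weilGroundEnergy_bddBelow.2 ⟨2 * B, fun a ha ↦ ?_⟩
  -- the window `a' = max a a₀` is at least `a₀` and at least `a`
  have key : ∀ a' : ℝ, a₀ ≤ a' → -(2 * B) ≤ weilGroundEnergy a' := by
    intro a' ha'
    obtain ⟨g, s, hg, hmin, hs, hZ⟩ := h a' ha'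
    have := weilGroundEnergy_ge_of_near_minimiser_zeroSum_le hg hmin hZ
    linarith
  have hmono : weilGroundEnergy (max a a₀) ≤ weilGroundEnergy a :=
    weilGroundEnergy_antitoneOn (mem_Ioi.2 ha) (mem_Ioi.2 (ha.trans_le (le_max_left _ _)))
      (le_max_left _ _)
  exact (key _ (le_max_right _ _)).trans hmono

/-- **RH ⟺ near-minimisers of bounded zero-sampling energy** (hypothesis-free form of the
visibility criterion).  Either the ground energy of every large window is approached, within a
bounded slack, by test functions whose zero sums `Σ_{|Im ρ| ≤ T} m(ρ)|ĝ(ρ)|²` stay bounded (RH),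
or every near-minimiser sequence has zero-sampling energy `→ ∞` (`¬`RH). -/
theorem riemannHypothesis_iff_near_minimisers_zeroSum_bounded :
    RiemannHypothesis ↔ ∃ B a₀ : ℝ, ∀ a : ℝ, a₀ ≤ a → ∃ (g : ℝ → ℂ) (s : ℝ), IsWeilTest g ∧
      (weilQuadratic g).re ≤ weilGroundEnergy a + s ∧ s ≤ B ∧
      ∀ T : ℝ, ∑ᶠ ρ ∈ weilZeroIndex T, (riemannZetaZeroOrder ρ : ℝ) * ‖weilMellin g ρ‖ ^ 2 ≤ B := by
  constructor
  · intro hRH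
    obtain ⟨B, a₀, h⟩ := near_minimisers_zeroSum_bounded_of_riemannHypothesis hRH
    refine ⟨B, a₀, fun a ha ↦ ?_⟩
    obtain ⟨g, s, hg, -, -, -, hmin, hs, hZ⟩ := h a ha
    exact ⟨g, s, hg, hmin, hs, hZ⟩
  · rintro ⟨B, a₀, h⟩
    exact riemannHypothesis_of_near_minimisers_zeroSum_bounded h

/-- Summit form. -/
theorem summit_iff_near_minimisers_zeroSum_bounded :
    Summit.RiemannHypothesis ↔ ∃ B a₀ : ℝ, ∀ a : ℝ, a₀ ≤ a → ∃ (g : ℝ → ℂ) (s : ℝ), IsWeilTest g ∧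
      (weilQuadratic g).re ≤ weilGroundEnergy a + s ∧ s ≤ B ∧
      ∀ T : ℝ, ∑ᶠ ρ ∈ weilZeroIndex T, (riemannZetaZeroOrder ρ : ℝ) * ‖weilMellin g ρ‖ ^ 2 ≤ B :=
  riemannHypothesis_iff_near_minimisers_zeroSum_bounded

end Negativity

end Summit.RiemannHypothesis.RiemannHypothesis.Theorems
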